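import Mathlib
import HarnessLib
import Summits.HubbardSuperconductivity.HubbardSuperconductivity.Theorems.KLProgrammeKLRegimeTwoVolumeTowerSpineDefs

/-!
# Route `KLProgramme` — crux K3, VL child `KLRegimeVolumeLimitV17F2` (stmt-HubbardSuperconductivity-20440), blueprint v5 M5: THE VOLUME-FREE SMALLNESS (H3)
# OF ONE SCALE OF THE TOWER SPINE FROM GEOMETRIC MAJORANTS (seat hubbard-kl-k3c4-p1 g14; `--supports` 20440)

`…TwoVolumeTowerSpineDefs.TowerScaleSmall κ κ′ aW aW′ cW κf cRb cCb δb ρ₀ ρf ρ₂ ρ′ ρ₃ NV NS ν₀ … ν₈` (field (H3) of `…TowerDataDefs.TowerData`) asks, for ONE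
scale of the nested two-volume induction, for ten dominating series to converge (to the named values `ν`) and for seven `θ < 1` lines.  Its inputs are
E1's L-free even profile `NV` of the scale, the L-free raw profile `NS` of the scale's states, and the scale's volume-free constants.  This file discharges it
by pure real analysis from GEOMETRIC MAJORANTS `NV m ≤ A·q^m`, `NS (2m) ≤ B·τ^m` (E1's budget law `CE^m ε_j^{m−1} 2^{(3m−5)j}` is of this shape at every
scale; the raw profile of the states IS geometric by the recursion (H2) of `TowerData`), given

* six RATIO conditions `w₀·q < 1`, `w₁·q < 1`, `w₁·cW²·τ < 1`, `w₆·(cW+δb)²·τ < 1`, `(e²(κ′+κ+ρf)/ρ₀)² < 1`, `(e²(3(κ′+κ)+ρ₂)/ρ₀)² < 1`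
  (`w₀ = (e²(κ+ρ₀))²`, `w₁ = (e²(κ′+ρ′))²`, `w₆ = (e²(κf+ρ₃))²` — the `normV` weights of `…TwoVolumeTowerStep`), and
* five SMALLNESS conditions in closed form on caller-named majorants `nb₀ ≥ A/(1−w₀q)`, `Db ≥ e·nb₀/(1 − e·aW·nb₀/κ²)`, `nb₃ ≥ A/(1−w₁q)`,
  `nbS ≥ cW·B/(1−x₁)`, `nbE ≥ cW·B·(6/(1−x₁) + 14·x₁/(1−x₁)²)`, `nb₇ ≥ cW·B/(1−x₆)`, `nb₈ ≥ 2B·y₆/(1−y₆)²` (`x₁ = w₁cW²τ`, `x₆ = w₆cW²τ`,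
  `y₆ = w₆(cW+δb)²τ`): `e·aW·nb₀/κ² < 1`, `e·2(aW′+aW)·(Db/(1−r₅))/(κ′+κ)² < 1`, `e·2(aW′+aW)·(Db/(1−r₄))/(3(κ′+κ))² < 1`,
  `e·aW′·((nb₃+(nbS+nb₃)) + nbE)/κ′² < 1`, `e·(aW′+(cRb+cCb))·(nb₇ + δb·nb₈)/κf² < 1`.

This is where the transfer constant `cW` of the scale is read («cW-BUDGET», KL STATUS 2026-08-28 l.4865/l.5212): only through `x₁, y₆ < 1` and the
majorants `nbS, nbE, nb₇, nb₈ ∝ B`, i.e. through `e²(κ′+ρ′)·cW·√τ < 1` with `τ = ρ₀(previous scale)⁻²` — a lower bound on the previous measuring radius,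
no structural cap.

* §1 series kit: `hasSum_const_mul_geometric`, `hasSum_const_mul_nat_mul_geometric`, `summable_hasSum_le_of_le`;
* §2 `towerScale_nu0_le`, `towerScale_D_bounds` — `ν₀ ≤ nb₀`, `θ₀ < 1`, `0 ≤ e·ν₀/(1−θ₀) ≤ Db`;
* §3 **`towerScaleSmall_of_geom`** — `∃ ν₁ ν₂ ν₃ ν₄ ν₅ νE ν₆ ν₇ ν₈, TowerScaleSmall …` (with the caller's `ν₀`, `HasSum`-named);
* ACROSS SCALES (the budgets `NS` by the recursion (H2) and (H2)–(H3) of `TowerData` for `j < J`): the sequel `…TwoVolumeTowerSmallnessGeom`.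

Proofs only; no definition; nothing about the model is asserted. [folklore: geometric series bookkeeping; cite: BenfattoGiulianiMastropietro2006, §3 (3.2)–(3.8) for the role]
-/

noncomputable section

namespace Summit.HubbardSuperconductivity.HubbardSuperconductivity.Theorems.TwoVolumeSource

set_option linter.dupNamespace false -- summit = problem name (single-conjunct summit), D-0017

open Finset Filter Topology

/-! ## §1 Series kit -/

/-- `Σ_m c·r^m = c/(1−r)` for `0 ≤ r < 1`. [folklore] -/
theorem hasSum_const_mul_geometric {c r : ℝ} (hr0 : 0 ≤ r) (hr1 : r < 1) :
    HasSum (fun m : ℕ => c * r ^ m) (c / (1 - r)) := by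
  simpa [div_eq_mul_inv] using (hasSum_geometric_of_lt_one hr0 hr1).mul_left c

/-- `Σ_m c·m·r^m = c·(r/(1−r)²)` for `0 ≤ r < 1`. [folklore] -/
theorem hasSum_const_mul_nat_mul_geometric {c r : ℝ} (hr0 : 0 ≤ r) (hr1 : r < 1) :
    HasSum (fun m : ℕ => c * ((m : ℝ) * r ^ m)) (c * (r / (1 - r) ^ 2)) :=
  (hasSum_coe_mul_geometric_of_norm_lt_one (by rwa [Real.norm_of_nonneg hr0])).mul_left c

/-- A nonnegative real series dominated termwise by a series with sum `S` sums (to its `tsum`) and the sum is `≤ S`. [folklore] -/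
theorem summable_hasSum_le_of_le {f g : ℕ → ℝ} {S : ℝ} (hf : ∀ m, 0 ≤ f m) (hfg : ∀ m, f m ≤ g m) (hg : HasSum g S) :
    HasSum f (∑' m, f m) ∧ ∑' m, f m ≤ S := by
  have hs : Summable f := Summable.of_nonneg_of_le hf hfg hg.summable
  exact ⟨hs.hasSum, hasSum_le hfg hs.hasSum hg⟩

/-- For `1 ≤ c`: `c^(2m−1) ≤ c^(2m)` (natural-number subtraction, so also at `m = 0`). [folklore] -/
theorem pow_two_mul_sub_one_le {c : ℝ} (hc : 1 ≤ c) (m : ℕ) : c ^ (2 * m - 1) ≤ c ^ (2 * m) :=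
  pow_le_pow_right₀ hc (Nat.sub_le _ _)

/-- `((2m−1 : ℕ) : ℝ) ≤ 2m`. [folklore] -/
theorem cast_two_mul_sub_one_le (m : ℕ) : ((2 * m - 1 : ℕ) : ℝ) ≤ 2 * (m : ℝ) := by
  have h : ((2 * m - 1 : ℕ) : ℝ) ≤ ((2 * m : ℕ) : ℝ) := by exact_mod_cast Nat.sub_le _ _
  simpa using h

/-! ## §2 The first series `ν₀` and the next raw budget `D = e·ν₀/(1−θ₀)` -/

/-- **`ν₀ ≤ nb₀`**: the first dominating series against its geometric majorant. [folklore] -/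
theorem towerScale_nu0_le {κ ρ₀ A q ν₀ nb₀ : ℝ} {NV : ℕ → ℝ} (hq : 0 ≤ q)
    (hNV0 : ∀ m, 0 ≤ NV m) (hNV : ∀ m, NV m ≤ A * q ^ m)
    (hν₀ : HasSum (fun m => (Real.exp 2 * (κ + ρ₀)) ^ (2 * m) * NV m) ν₀)
    (hr₀ : (Real.exp 2 * (κ + ρ₀)) ^ 2 * q < 1) (hnb₀ : A / (1 - (Real.exp 2 * (κ + ρ₀)) ^ 2 * q) ≤ nb₀) :
    0 ≤ ν₀ ∧ ν₀ ≤ nb₀ := by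
  have hw : 0 ≤ (Real.exp 2 * (κ + ρ₀)) ^ 2 := sq_nonneg _
  have hg := hasSum_const_mul_geometric (c := A) (mul_nonneg hw hq) hr₀
  have hle : ∀ m, (Real.exp 2 * (κ + ρ₀)) ^ (2 * m) * NV m ≤ A * ((Real.exp 2 * (κ + ρ₀)) ^ 2 * q) ^ m := fun m => by
    rw [pow_mul]
    calc ((Real.exp 2 * (κ + ρ₀)) ^ 2) ^ m * NV m ≤ ((Real.exp 2 * (κ + ρ₀)) ^ 2) ^ m * (A * q ^ m) :=
          mul_le_mul_of_nonneg_left (hNV m) (pow_nonneg hw m)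
      _ = A * ((Real.exp 2 * (κ + ρ₀)) ^ 2 * q) ^ m := by rw [mul_pow ((Real.exp 2 * (κ + ρ₀)) ^ 2) q m, mul_left_comm]
  exact ⟨hν₀.nonneg fun m => mul_nonneg (by rw [pow_mul]; exact pow_nonneg hw m) (hNV0 m),
    (hasSum_le hle hν₀ hg).trans hnb₀⟩

/-- **The next raw budget** `D = e·ν₀/(1 − e·aW·ν₀/κ²)`: `θ₀ < 1` and `0 ≤ D ≤ Db`. [folklore] -/
theorem towerScale_D_bounds {κ aW ν₀ nb₀ Db : ℝ} (hκ : 0 < κ) (haW : 0 ≤ aW) (hν₀0 : 0 ≤ ν₀) (hν₀ : ν₀ ≤ nb₀)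
    (hθ : Real.exp 1 * aW * nb₀ / κ ^ 2 < 1) (hDb : Real.exp 1 * nb₀ / (1 - Real.exp 1 * aW * nb₀ / κ ^ 2) ≤ Db) :
    Real.exp 1 * aW * ν₀ / κ ^ 2 < 1 ∧ 0 ≤ Real.exp 1 * ν₀ / (1 - Real.exp 1 * aW * ν₀ / κ ^ 2) ∧
      Real.exp 1 * ν₀ / (1 - Real.exp 1 * aW * ν₀ / κ ^ 2) ≤ Db := by
  have hE : 0 < Real.exp 1 := Real.exp_pos 1
  have hmono : Real.exp 1 * aW * ν₀ / κ ^ 2 ≤ Real.exp 1 * aW * nb₀ / κ ^ 2 := by gcongr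
  have hθ₀ : Real.exp 1 * aW * ν₀ / κ ^ 2 < 1 := hmono.trans_lt hθ
  refine ⟨hθ₀, div_nonneg (by positivity) (by linarith), le_trans ?_ hDb⟩
  exact div_le_div₀ (mul_nonneg hE.le (hν₀0.trans hν₀)) (by gcongr) (by linarith) (by linarith)

/-! ## §3 One scale -/

/-- **(H3) OF ONE SCALE FROM GEOMETRIC MAJORANTS** (see the module docstring): given the scale's constants, E1's even profile `NV ≤ A·q^m`, the raw profile
`NS (2m) ≤ B·τ^m` of the scale's states, the first series value `ν₀` (named by the caller, `HasSum`), six ratio conditions and five closed-form smallness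
conditions on caller-named majorants, the remaining nine series values exist and `TowerScaleSmall` holds. [folklore: geometric series] -/
theorem towerScaleSmall_of_geom {κ κ' aW aW' cW κf cRb cCb δb ρ₀ ρf ρ₂ ρ' ρ₃ A q B τ ν₀ nb₀ Db nb₃ nbS nbE nb₇ nb₈ : ℝ} {NV NS : ℕ → ℝ}
    (hκ : 0 < κ) (haW : 0 ≤ aW) (haW' : 0 ≤ aW') (hcW : 1 ≤ cW) (hcRb : 0 ≤ cRb) (hcCb : 0 ≤ cCb) (hδb : 0 ≤ δb)
    (hq : 0 ≤ q) (hτ : 0 ≤ τ)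
    (hNV0 : ∀ m, 0 ≤ NV m) (hNV : ∀ m, NV m ≤ A * q ^ m) (hNS0 : ∀ m, 0 ≤ NS (2 * m)) (hNS : ∀ m, NS (2 * m) ≤ B * τ ^ m)
    (hν₀ : HasSum (fun m => (Real.exp 2 * (κ + ρ₀)) ^ (2 * m) * NV m) ν₀)
    -- the six ratios
    (hr₀ : (Real.exp 2 * (κ + ρ₀)) ^ 2 * q < 1)
    (hr₅ : (Real.exp 2 * (κ' + κ + ρf)) ^ 2 * ρ₀⁻¹ ^ 2 < 1)
    (hr₄ : (Real.exp 2 * (κ' + κ + (κ' + κ + (κ' + κ)) + ρ₂)) ^ 2 * ρ₀⁻¹ ^ 2 < 1)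
    (hr₁ : (Real.exp 2 * (κ' + ρ')) ^ 2 * q < 1)
    (hx₁ : (Real.exp 2 * (κ' + ρ')) ^ 2 * (cW ^ 2 * τ) < 1)
    (hy₆ : (Real.exp 2 * (κf + ρ₃)) ^ 2 * ((cW + δb) ^ 2 * τ) < 1)
    -- the caller-named majorants
    (hnb₀ : A / (1 - (Real.exp 2 * (κ + ρ₀)) ^ 2 * q) ≤ nb₀)
    (hDb : Real.exp 1 * nb₀ / (1 - Real.exp 1 * aW * nb₀ / κ ^ 2) ≤ Db)
    (hnb₃ : A / (1 - (Real.exp 2 * (κ' + ρ')) ^ 2 * q) ≤ nb₃)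
    (hnbS : cW * B / (1 - (Real.exp 2 * (κ' + ρ')) ^ 2 * (cW ^ 2 * τ)) ≤ nbS)
    (hnbE : cW * B * (6 / (1 - (Real.exp 2 * (κ' + ρ')) ^ 2 * (cW ^ 2 * τ)) +
      14 * ((Real.exp 2 * (κ' + ρ')) ^ 2 * (cW ^ 2 * τ) / (1 - (Real.exp 2 * (κ' + ρ')) ^ 2 * (cW ^ 2 * τ)) ^ 2)) ≤ nbE)
    (hnb₇ : cW * B / (1 - (Real.exp 2 * (κf + ρ₃)) ^ 2 * (cW ^ 2 * τ)) ≤ nb₇)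
    (hnb₈ : 2 * B * ((Real.exp 2 * (κf + ρ₃)) ^ 2 * ((cW + δb) ^ 2 * τ) / (1 - (Real.exp 2 * (κf + ρ₃)) ^ 2 * ((cW + δb) ^ 2 * τ)) ^ 2) ≤ nb₈)
    -- the five smallness lines
    (hθ₀ : Real.exp 1 * aW * nb₀ / κ ^ 2 < 1)
    (hθw : Real.exp 1 * (aW' + aW + (aW' + aW)) * (Db / (1 - (Real.exp 2 * (κ' + κ + ρf)) ^ 2 * ρ₀⁻¹ ^ 2)) / (κ' + κ) ^ 2 < 1)
    (hθ₂ : Real.exp 1 * (aW' + aW + (aW' + aW)) * (Db / (1 - (Real.exp 2 * (κ' + κ + (κ' + κ + (κ' + κ)) + ρ₂)) ^ 2 * ρ₀⁻¹ ^ 2)) /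
      (κ' + κ + (κ' + κ + (κ' + κ))) ^ 2 < 1)
    (hbar : Real.exp 1 * aW' * ((nb₃ + (nbS + nb₃)) + nbE) / κ' ^ 2 < 1)
    (hθf : Real.exp 1 * (aW' + (cRb + cCb)) * (nb₇ + δb * nb₈) / κf ^ 2 < 1) :
    ∃ ν₁ ν₂ ν₃ ν₄ ν₅ νE ν₆ ν₇ ν₈ : ℝ,
      TowerScaleSmall κ κ' aW aW' cW κf cRb cCb δb ρ₀ ρf ρ₂ ρ' ρ₃ NV NS ν₀ ν₁ ν₂ ν₃ ν₄ ν₅ νE ν₆ ν₇ ν₈ := by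
  have hE : 0 < Real.exp 1 := Real.exp_pos 1
  -- §2: the first series and the next raw budget
  obtain ⟨hν₀0, hν₀le⟩ := towerScale_nu0_le hq hNV0 hNV hν₀ hr₀ hnb₀
  obtain ⟨hθ₀', hD0, hDle⟩ := towerScale_D_bounds hκ haW hν₀0 hν₀le hθ₀ hDb
  set D : ℝ := Real.exp 1 * ν₀ / (1 - Real.exp 1 * aW * ν₀ / κ ^ 2) with hDdef
  -- names for the squared weights and the ratios
  obtain ⟨W₅, hW₅⟩ : ∃ W : ℝ, W = (Real.exp 2 * (κ' + κ + ρf)) ^ 2 := ⟨_, rfl⟩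
  obtain ⟨W₄, hW₄⟩ : ∃ W : ℝ, W = (Real.exp 2 * (κ' + κ + (κ' + κ + (κ' + κ)) + ρ₂)) ^ 2 := ⟨_, rfl⟩
  obtain ⟨W₁, hW₁⟩ : ∃ W : ℝ, W = (Real.exp 2 * (κ' + ρ')) ^ 2 := ⟨_, rfl⟩
  obtain ⟨W₆, hW₆⟩ : ∃ W : ℝ, W = (Real.exp 2 * (κf + ρ₃)) ^ 2 := ⟨_, rfl⟩
  obtain ⟨R, hR⟩ : ∃ R : ℝ, R = ρ₀⁻¹ ^ 2 := ⟨_, rfl⟩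
  have hW₅0 : 0 ≤ W₅ := hW₅ ▸ sq_nonneg _
  have hW₄0 : 0 ≤ W₄ := hW₄ ▸ sq_nonneg _
  have hW₁0 : 0 ≤ W₁ := hW₁ ▸ sq_nonneg _
  have hW₆0 : 0 ≤ W₆ := hW₆ ▸ sq_nonneg _
  have hR0 : 0 ≤ R := hR ▸ sq_nonneg _
  have hcW0 : 0 ≤ cW := zero_le_one.trans hcW
  have hcd1 : 1 ≤ cW + δb := hcW.trans (le_add_of_nonneg_right hδb)
  rw [← hW₅, ← hR] at hr₅ hθw
  rw [← hW₄, ← hR] at hr₄ hθ₂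
  rw [← hW₁] at hr₁ hx₁ hnb₃ hnbS hnbE
  rw [← hW₆] at hy₆ hnb₇ hnb₈
  have hx₆ : W₆ * (cW ^ 2 * τ) < 1 := by
    refine lt_of_le_of_lt ?_ hy₆
    have : cW ^ 2 ≤ (cW + δb) ^ 2 := pow_le_pow_left₀ hcW0 (le_add_of_nonneg_right hδb) 2
    gcongr
  have hr₅0 : 0 ≤ W₅ * R := mul_nonneg hW₅0 hR0
  have hr₄0 : 0 ≤ W₄ * R := mul_nonneg hW₄0 hR0
  have hr₁0 : 0 ≤ W₁ * q := mul_nonneg hW₁0 hq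
  have hx₁0 : 0 ≤ W₁ * (cW ^ 2 * τ) := by positivity
  have hx₆0 : 0 ≤ W₆ * (cW ^ 2 * τ) := by positivity
  have hy₆0 : 0 ≤ W₆ * ((cW + δb) ^ 2 * τ) := by positivity
  -- the elementary termwise bounds
  have hP : ∀ m, cW ^ (2 * m - 1) ≤ (cW ^ 2) ^ m := fun m => (pow_two_mul_sub_one_le hcW m).trans_eq (pow_mul cW 2 m)
  have hP' : ∀ m, (cW + δb) ^ (2 * m - 1) ≤ ((cW + δb) ^ 2) ^ m := fun m =>
    (pow_two_mul_sub_one_le hcd1 m).trans_eq (pow_mul _ 2 m)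
  have hPN : ∀ m, cW ^ (2 * m - 1) * (cW * NS (2 * m)) ≤ cW * B * (cW ^ 2 * τ) ^ m := fun m => by
    calc cW ^ (2 * m - 1) * (cW * NS (2 * m)) ≤ (cW ^ 2) ^ m * (cW * (B * τ ^ m)) :=
          mul_le_mul (hP m) (mul_le_mul_of_nonneg_left (hNS m) hcW0) (mul_nonneg hcW0 (hNS0 m)) (pow_nonneg (sq_nonneg _) m)
      _ = cW * B * (cW ^ 2 * τ) ^ m := by rw [mul_pow]; ring
  have hPN0 : ∀ m, 0 ≤ cW ^ (2 * m - 1) * (cW * NS (2 * m)) := fun m => mul_nonneg (pow_nonneg hcW0 _) (mul_nonneg hcW0 (hNS0 m))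
  have hNVw : ∀ (W : ℝ), 0 ≤ W → ∀ m, W ^ m * NV m ≤ A * (W * q) ^ m := fun W hW m => by
    calc W ^ m * NV m ≤ W ^ m * (A * q ^ m) := mul_le_mul_of_nonneg_left (hNV m) (pow_nonneg hW m)
      _ = A * (W * q) ^ m := by rw [mul_pow W q m, mul_left_comm]
  -- ν₅, ν₄ : exact geometric series
  have h5 : HasSum (fun m => (Real.exp 2 * (κ' + κ + ρf)) ^ (2 * m) * (ρ₀⁻¹ ^ (2 * m) * (Real.exp 1 * ν₀) / (1 - Real.exp 1 * aW * ν₀ / κ ^ 2)))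
      (D / (1 - W₅ * R)) := by
    convert hasSum_const_mul_geometric (c := D) hr₅0 hr₅ using 1
    funext m
    rw [pow_mul, pow_mul, ← hW₅, ← hR, hDdef, mul_pow]
    ring
  have h4 : HasSum (fun m => (Real.exp 2 * (κ' + κ + (κ' + κ + (κ' + κ)) + ρ₂)) ^ (2 * m) *
      (ρ₀⁻¹ ^ (2 * m) * (Real.exp 1 * ν₀) / (1 - Real.exp 1 * aW * ν₀ / κ ^ 2))) (D / (1 - W₄ * R)) := by
    convert hasSum_const_mul_geometric (c := D) hr₄0 hr₄ using 1
    funext m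
    rw [pow_mul, pow_mul, ← hW₄, ← hR, hDdef, mul_pow]
    ring
  -- the geometric comparison series at weight `W₁`
  have hg3 : HasSum (fun m => A * (W₁ * q) ^ m) (A / (1 - W₁ * q)) := hasSum_const_mul_geometric hr₁0 hr₁
  have hgS : HasSum (fun m => cW * B * (W₁ * (cW ^ 2 * τ)) ^ m) (cW * B / (1 - W₁ * (cW ^ 2 * τ))) := hasSum_const_mul_geometric hx₁0 hx₁
  have hgE : HasSum (fun m : ℕ => cW * B * (6 * (W₁ * (cW ^ 2 * τ)) ^ m + 14 * ((m : ℝ) * (W₁ * (cW ^ 2 * τ)) ^ m)))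
      (cW * B * (6 / (1 - W₁ * (cW ^ 2 * τ)) + 14 * (W₁ * (cW ^ 2 * τ) / (1 - W₁ * (cW ^ 2 * τ)) ^ 2))) :=
    ((hasSum_const_mul_geometric (c := 6) hx₁0 hx₁).add (hasSum_const_mul_nat_mul_geometric (c := 14) hx₁0 hx₁)).mul_left _
  -- ν₃
  obtain ⟨h3, h3le⟩ := summable_hasSum_le_of_le (f := fun m => (Real.exp 2 * (κ' + ρ')) ^ (2 * m) * NV m)
    (fun m => mul_nonneg (by rw [pow_mul]; exact pow_nonneg (sq_nonneg _) m) (hNV0 m))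
    (fun m => by rw [pow_mul, ← hW₁]; exact hNVw W₁ hW₁0 m) hg3
  -- ν₂
  obtain ⟨h2, h2le⟩ := summable_hasSum_le_of_le
    (f := fun m => (Real.exp 2 * (κ' + ρ')) ^ (2 * m) * (cW ^ (2 * m - 1) * (cW * NS (2 * m)) + NV m))
    (fun m => mul_nonneg (by rw [pow_mul]; exact pow_nonneg (sq_nonneg _) m) (add_nonneg (hPN0 m) (hNV0 m)))
    (fun m => by
      rw [pow_mul, ← hW₁, mul_add]
      refine add_le_add ?_ (hNVw W₁ hW₁0 m)
      calc W₁ ^ m * (cW ^ (2 * m - 1) * (cW * NS (2 * m))) ≤ W₁ ^ m * (cW * B * (cW ^ 2 * τ) ^ m) :=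
            mul_le_mul_of_nonneg_left (hPN m) (pow_nonneg hW₁0 m)
        _ = cW * B * (W₁ * (cW ^ 2 * τ)) ^ m := by rw [mul_pow W₁ (cW ^ 2 * τ) m]; ring)
    (hgS.add hg3)
  -- ν₁
  obtain ⟨h1, h1le⟩ := summable_hasSum_le_of_le
    (f := fun m => (Real.exp 2 * (κ' + ρ')) ^ (2 * m) * (NV m + (cW ^ (2 * m - 1) * (cW * NS (2 * m)) + NV m)))
    (fun m => mul_nonneg (by rw [pow_mul]; exact pow_nonneg (sq_nonneg _) m) (add_nonneg (hNV0 m) (add_nonneg (hPN0 m) (hNV0 m))))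
    (fun m => by
      rw [pow_mul, ← hW₁, mul_add, mul_add]
      refine add_le_add (hNVw W₁ hW₁0 m) (add_le_add ?_ (hNVw W₁ hW₁0 m))
      calc W₁ ^ m * (cW ^ (2 * m - 1) * (cW * NS (2 * m))) ≤ W₁ ^ m * (cW * B * (cW ^ 2 * τ) ^ m) :=
            mul_le_mul_of_nonneg_left (hPN m) (pow_nonneg hW₁0 m)
        _ = cW * B * (W₁ * (cW ^ 2 * τ)) ^ m := by rw [mul_pow W₁ (cW ^ 2 * τ) m]; ring)
    (hg3.add (hgS.add hg3))
  -- νE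
  obtain ⟨hEE, hEle⟩ := summable_hasSum_le_of_le
    (f := fun m => (Real.exp 2 * (κ' + ρ')) ^ (2 * m) *
      (cW ^ (2 * m - 1) * (cW * (2 * NS (2 * m)) + cW * (2 * NS (2 * m))) +
        (2 * cW ^ (2 * m - 1) * cW * NS (2 * m) + ((2 * m - 1 : ℕ) : ℝ) * cW ^ (2 * m - 1) * (5 * cW * NS (2 * m) + 2 * cW * NS (2 * m)))))
    (fun m => by
      have h1 := hPN0 m
      have h2 : (0 : ℝ) ≤ ((2 * m - 1 : ℕ) : ℝ) := Nat.cast_nonneg _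
      have h3 : 0 ≤ (Real.exp 2 * (κ' + ρ')) ^ (2 * m) := by rw [pow_mul]; exact pow_nonneg (sq_nonneg _) m
      have : 0 ≤ cW ^ (2 * m - 1) * (cW * (2 * NS (2 * m)) + cW * (2 * NS (2 * m))) +
          (2 * cW ^ (2 * m - 1) * cW * NS (2 * m) + ((2 * m - 1 : ℕ) : ℝ) * cW ^ (2 * m - 1) * (5 * cW * NS (2 * m) + 2 * cW * NS (2 * m))) := by
        have : cW ^ (2 * m - 1) * (cW * (2 * NS (2 * m)) + cW * (2 * NS (2 * m))) +
            (2 * cW ^ (2 * m - 1) * cW * NS (2 * m) + ((2 * m - 1 : ℕ) : ℝ) * cW ^ (2 * m - 1) * (5 * cW * NS (2 * m) + 2 * cW * NS (2 * m))) =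
            (6 + 7 * ((2 * m - 1 : ℕ) : ℝ)) * (cW ^ (2 * m - 1) * (cW * NS (2 * m))) := by ring
        rw [this]; positivity
      exact mul_nonneg h3 this)
    (fun m => by
      rw [pow_mul, ← hW₁]
      have hid : cW ^ (2 * m - 1) * (cW * (2 * NS (2 * m)) + cW * (2 * NS (2 * m))) +
          (2 * cW ^ (2 * m - 1) * cW * NS (2 * m) + ((2 * m - 1 : ℕ) : ℝ) * cW ^ (2 * m - 1) * (5 * cW * NS (2 * m) + 2 * cW * NS (2 * m))) =
          (6 + 7 * ((2 * m - 1 : ℕ) : ℝ)) * (cW ^ (2 * m - 1) * (cW * NS (2 * m))) := by ring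
      rw [hid]
      have hfac : (6 + 7 * ((2 * m - 1 : ℕ) : ℝ)) ≤ 6 + 14 * (m : ℝ) := by linarith [cast_two_mul_sub_one_le m]
      calc W₁ ^ m * ((6 + 7 * ((2 * m - 1 : ℕ) : ℝ)) * (cW ^ (2 * m - 1) * (cW * NS (2 * m))))
          ≤ W₁ ^ m * ((6 + 14 * (m : ℝ)) * (cW * B * (cW ^ 2 * τ) ^ m)) :=
            mul_le_mul_of_nonneg_left (mul_le_mul hfac (hPN m) (hPN0 m) (by positivity)) (pow_nonneg hW₁0 m)
        _ = cW * B * (6 * (W₁ * (cW ^ 2 * τ)) ^ m + 14 * ((m : ℝ) * (W₁ * (cW ^ 2 * τ)) ^ m)) := by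
            rw [mul_pow W₁ (cW ^ 2 * τ) m]; ring)
    hgE
  -- the geometric comparison series at weight `W₆`
  have hg7 : HasSum (fun m => cW * B * (W₆ * (cW ^ 2 * τ)) ^ m) (cW * B / (1 - W₆ * (cW ^ 2 * τ))) := hasSum_const_mul_geometric hx₆0 hx₆
  have hg8 : HasSum (fun m : ℕ => 2 * B * ((m : ℝ) * (W₆ * ((cW + δb) ^ 2 * τ)) ^ m))
      (2 * B * (W₆ * ((cW + δb) ^ 2 * τ) / (1 - W₆ * ((cW + δb) ^ 2 * τ)) ^ 2)) := hasSum_const_mul_nat_mul_geometric hy₆0 hy₆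
  have hQN : ∀ m, ((2 * m : ℕ) : ℝ) * (cW + δb) ^ (2 * m - 1) * NS (2 * m) ≤ 2 * B * ((m : ℝ) * ((cW + δb) ^ 2 * τ) ^ m) := fun m => by
    have h2m : ((2 * m : ℕ) : ℝ) = 2 * (m : ℝ) := by push_cast; ring
    rw [h2m]
    calc 2 * (m : ℝ) * (cW + δb) ^ (2 * m - 1) * NS (2 * m) ≤ 2 * (m : ℝ) * ((cW + δb) ^ 2) ^ m * (B * τ ^ m) :=
          mul_le_mul (mul_le_mul_of_nonneg_left (hP' m) (by positivity)) (hNS m) (hNS0 m) (by positivity)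
      _ = 2 * B * ((m : ℝ) * ((cW + δb) ^ 2 * τ) ^ m) := by rw [mul_pow ((cW + δb) ^ 2) τ m]; ring
  have hQN0 : ∀ m, 0 ≤ ((2 * m : ℕ) : ℝ) * (cW + δb) ^ (2 * m - 1) * NS (2 * m) := fun m =>
    mul_nonneg (mul_nonneg (Nat.cast_nonneg _) (pow_nonneg (zero_le_one.trans hcd1) _)) (hNS0 m)
  -- ν₇
  obtain ⟨h7, h7le⟩ := summable_hasSum_le_of_le
    (f := fun m => (Real.exp 2 * (κf + ρ₃)) ^ (2 * m) * (cW ^ (2 * m - 1) * (cW * NS (2 * m))))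
    (fun m => mul_nonneg (by rw [pow_mul]; exact pow_nonneg (sq_nonneg _) m) (hPN0 m))
    (fun m => by
      rw [pow_mul, ← hW₆]
      calc W₆ ^ m * (cW ^ (2 * m - 1) * (cW * NS (2 * m))) ≤ W₆ ^ m * (cW * B * (cW ^ 2 * τ) ^ m) :=
            mul_le_mul_of_nonneg_left (hPN m) (pow_nonneg hW₆0 m)
        _ = cW * B * (W₆ * (cW ^ 2 * τ)) ^ m := by rw [mul_pow W₆ (cW ^ 2 * τ) m]; ring)
    hg7
  -- ν₈
  obtain ⟨h8, h8le⟩ := summable_hasSum_le_of_le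
    (f := fun m => (Real.exp 2 * (κf + ρ₃)) ^ (2 * m) * (((2 * m : ℕ) : ℝ) * (cW + δb) ^ (2 * m - 1) * NS (2 * m)))
    (fun m => mul_nonneg (by rw [pow_mul]; exact pow_nonneg (sq_nonneg _) m) (hQN0 m))
    (fun m => by
      rw [pow_mul, ← hW₆]
      calc W₆ ^ m * (((2 * m : ℕ) : ℝ) * (cW + δb) ^ (2 * m - 1) * NS (2 * m)) ≤ W₆ ^ m * (2 * B * ((m : ℝ) * ((cW + δb) ^ 2 * τ) ^ m)) :=
            mul_le_mul_of_nonneg_left (hQN m) (pow_nonneg hW₆0 m)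
        _ = 2 * B * ((m : ℝ) * (W₆ * ((cW + δb) ^ 2 * τ)) ^ m) := by rw [mul_pow W₆ ((cW + δb) ^ 2 * τ) m]; ring)
    hg8
  -- ν₆
  obtain ⟨h6, h6le⟩ := summable_hasSum_le_of_le
    (f := fun m => (Real.exp 2 * (κf + ρ₃)) ^ (2 * m) *
      (cW ^ (2 * m - 1) * (cW * NS (2 * m)) + ((2 * m : ℕ) : ℝ) * (cW + δb) ^ (2 * m - 1) * δb * NS (2 * m)))
    (fun m => mul_nonneg (by rw [pow_mul]; exact pow_nonneg (sq_nonneg _) m) (add_nonneg (hPN0 m) (by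
      have := hQN0 m
      have h' : ((2 * m : ℕ) : ℝ) * (cW + δb) ^ (2 * m - 1) * δb * NS (2 * m) = δb * (((2 * m : ℕ) : ℝ) * (cW + δb) ^ (2 * m - 1) * NS (2 * m)) := by
        ring
      rw [h']; exact mul_nonneg hδb this)))
    (fun m => by
      rw [pow_mul, ← hW₆, mul_add]
      refine add_le_add ?_ ?_
      · calc W₆ ^ m * (cW ^ (2 * m - 1) * (cW * NS (2 * m))) ≤ W₆ ^ m * (cW * B * (cW ^ 2 * τ) ^ m) :=
              mul_le_mul_of_nonneg_left (hPN m) (pow_nonneg hW₆0 m)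
          _ = cW * B * (W₆ * (cW ^ 2 * τ)) ^ m := by rw [mul_pow W₆ (cW ^ 2 * τ) m]; ring
      · have h' : ((2 * m : ℕ) : ℝ) * (cW + δb) ^ (2 * m - 1) * δb * NS (2 * m) = δb * (((2 * m : ℕ) : ℝ) * (cW + δb) ^ (2 * m - 1) * NS (2 * m)) := by
          ring
        rw [h']
        calc W₆ ^ m * (δb * (((2 * m : ℕ) : ℝ) * (cW + δb) ^ (2 * m - 1) * NS (2 * m))) ≤ W₆ ^ m * (δb * (2 * B * ((m : ℝ) * ((cW + δb) ^ 2 * τ) ^ m))) :=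
              mul_le_mul_of_nonneg_left (mul_le_mul_of_nonneg_left (hQN m) hδb) (pow_nonneg hW₆0 m)
          _ = δb * (2 * B * ((m : ℝ) * (W₆ * ((cW + δb) ^ 2 * τ)) ^ m)) := by rw [mul_pow W₆ ((cW + δb) ^ 2 * τ) m]; ring)
    (hg7.add (hg8.mul_left δb))
  -- nonnegativity of the majorants used in the monotonicity steps
  have hnb₃0 : 0 ≤ nb₃ := le_trans (by exact le_trans (tsum_nonneg fun m => mul_nonneg (by rw [pow_mul]; exact pow_nonneg (sq_nonneg _) m) (hNV0 m)) h3le) hnb₃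
  have hnbE0 : 0 ≤ nbE := le_trans (le_trans (hEE.nonneg fun m => ?_) hEle) hnbE
  swap
  · have h3 : 0 ≤ (Real.exp 2 * (κ' + ρ')) ^ (2 * m) := by rw [pow_mul]; exact pow_nonneg (sq_nonneg _) m
    have : cW ^ (2 * m - 1) * (cW * (2 * NS (2 * m)) + cW * (2 * NS (2 * m))) +
        (2 * cW ^ (2 * m - 1) * cW * NS (2 * m) + ((2 * m - 1 : ℕ) : ℝ) * cW ^ (2 * m - 1) * (5 * cW * NS (2 * m) + 2 * cW * NS (2 * m))) =
        (6 + 7 * ((2 * m - 1 : ℕ) : ℝ)) * (cW ^ (2 * m - 1) * (cW * NS (2 * m))) := by ring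
    rw [this]
    have := hPN0 m
    positivity
  have hν₇0 : 0 ≤ ∑' m, (Real.exp 2 * (κf + ρ₃)) ^ (2 * m) * (cW ^ (2 * m - 1) * (cW * NS (2 * m))) :=
    tsum_nonneg fun m => mul_nonneg (by rw [pow_mul]; exact pow_nonneg (sq_nonneg _) m) (hPN0 m)
  have hν₈0 : 0 ≤ ∑' m, (Real.exp 2 * (κf + ρ₃)) ^ (2 * m) * (((2 * m : ℕ) : ℝ) * (cW + δb) ^ (2 * m - 1) * NS (2 * m)) :=
    tsum_nonneg fun m => mul_nonneg (by rw [pow_mul]; exact pow_nonneg (sq_nonneg _) m) (hQN0 m)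
  have hnb₇le := h7le.trans hnb₇
  have hnb₈le := h8le.trans hnb₈
  refine ⟨_, _, _, _, _, _, _, _, _,
    { hν₀ := hν₀
      hθ₀ := hθ₀'
      hν₅ := h5
      hθw := lt_of_le_of_lt ?_ hθw
      hν₄ := h4
      hθ₂ := lt_of_le_of_lt ?_ hθ₂
      hν₁ := h1
      hν₂ := h2
      hν₃ := h3
      hνE := hEE
      hbar := lt_of_le_of_lt ?_ hbar
      hθ₂' := lt_of_le_of_lt ?_ hbar
      hν₆ := h6
      hν₇ := h7
      hν₈ := h8
      hθf₁ := lt_of_le_of_lt ?_ hθf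
      hθf₂ := lt_of_le_of_lt ?_ hθf }⟩
  · -- θw
    have : D / (1 - W₅ * R) ≤ Db / (1 - W₅ * R) := div_le_div_of_nonneg_right hDle (by linarith)
    gcongr
  · -- θ₂
    have : D / (1 - W₄ * R) ≤ Db / (1 - W₄ * R) := div_le_div_of_nonneg_right hDle (by linarith)
    gcongr
  · -- bar
    have : (∑' m, (Real.exp 2 * (κ' + ρ')) ^ (2 * m) * (NV m + (cW ^ (2 * m - 1) * (cW * NS (2 * m)) + NV m))) +
        (∑' m, (Real.exp 2 * (κ' + ρ')) ^ (2 * m) *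
          (cW ^ (2 * m - 1) * (cW * (2 * NS (2 * m)) + cW * (2 * NS (2 * m))) +
            (2 * cW ^ (2 * m - 1) * cW * NS (2 * m) + ((2 * m - 1 : ℕ) : ℝ) * cW ^ (2 * m - 1) * (5 * cW * NS (2 * m) + 2 * cW * NS (2 * m))))) ≤
        (nb₃ + (nbS + nb₃)) + nbE := add_le_add (h1le.trans (add_le_add hnb₃ (add_le_add hnbS hnb₃))) (hEle.trans hnbE)
    gcongr
  · -- θ₂'
    have : (∑' m, (Real.exp 2 * (κ' + ρ')) ^ (2 * m) * NV m) +
        (∑' m, (Real.exp 2 * (κ' + ρ')) ^ (2 * m) * (cW ^ (2 * m - 1) * (cW * NS (2 * m)) + NV m)) ≤ (nb₃ + (nbS + nb₃)) + nbE :=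
      le_add_of_le_of_nonneg (add_le_add (h3le.trans hnb₃) (h2le.trans (add_le_add hnbS hnb₃))) hnbE0
    gcongr
  · -- θf₁
    have : (∑' m, (Real.exp 2 * (κf + ρ₃)) ^ (2 * m) *
        (cW ^ (2 * m - 1) * (cW * NS (2 * m)) + ((2 * m : ℕ) : ℝ) * (cW + δb) ^ (2 * m - 1) * δb * NS (2 * m))) ≤ nb₇ + δb * nb₈ :=
      h6le.trans (add_le_add hnb₇ (mul_le_mul_of_nonneg_left hnb₈ hδb))
    gcongr
  · -- θf₂
    have hsum : (∑' m, (Real.exp 2 * (κf + ρ₃)) ^ (2 * m) * (cW ^ (2 * m - 1) * (cW * NS (2 * m)))) +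
        δb * (∑' m, (Real.exp 2 * (κf + ρ₃)) ^ (2 * m) * (((2 * m : ℕ) : ℝ) * (cW + δb) ^ (2 * m - 1) * NS (2 * m))) ≤ nb₇ + δb * nb₈ :=
      add_le_add hnb₇le (mul_le_mul_of_nonneg_left hnb₈le hδb)
    have haW'le : aW' ≤ aW' + (cRb + cCb) := le_add_of_nonneg_right (add_nonneg hcRb hcCb)
    have h0 : 0 ≤ (∑' m, (Real.exp 2 * (κf + ρ₃)) ^ (2 * m) * (cW ^ (2 * m - 1) * (cW * NS (2 * m)))) +
        δb * (∑' m, (Real.exp 2 * (κf + ρ₃)) ^ (2 * m) * (((2 * m : ℕ) : ℝ) * (cW + δb) ^ (2 * m - 1) * NS (2 * m))) :=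
      add_nonneg hν₇0 (mul_nonneg hδb hν₈0)
    calc Real.exp 1 * aW' * ((∑' m, (Real.exp 2 * (κf + ρ₃)) ^ (2 * m) * (cW ^ (2 * m - 1) * (cW * NS (2 * m)))) +
          δb * (∑' m, (Real.exp 2 * (κf + ρ₃)) ^ (2 * m) * (((2 * m : ℕ) : ℝ) * (cW + δb) ^ (2 * m - 1) * NS (2 * m)))) / κf ^ 2
        ≤ Real.exp 1 * (aW' + (cRb + cCb)) * (nb₇ + δb * nb₈) / κf ^ 2 := by gcongr

end Summit.HubbardSuperconductivity.HubbardSuperconductivity.Theorems.TwoVolumeSource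

end
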